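import Mathlib
import HarnessLib
import Summits.MatrixMultiplication.MatrixMultiplication.Theorems.OutsiderSandwichCapSetFloors
import Summits.MatrixMultiplication.MatrixMultiplication.Theorems.OutsiderSandwichPackFloors

/-!
# The `112`-cap of `𝔽₃^6` and the floors `Q_ℂ(cw₂^{⊠11}) ≥ 27216`, `Q_ℂ(cw₂^{⊠12}) ≥ 81648`

Fourth part of K41 (helper for `LaserTangency`, route OutsiderSandwich; lens «minimal counterexample /
extremal reduction» of the `decomp-mm` cell).  The cap-set lift
`OutsiderSandwichCapSetLift.le_subrank_cwPow_of_cap` (`cw₂^{⊠N} ≥ ⟨|Λ|·3^{N−k}⟩` for a cap `Λ ⊂ 𝔽₃^k`,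
`k ≤ N ≤ 2k`) was fed in `OutsiderSandwichCapSetFloors` with the caps `9, 20, 45` (`k = 3, 4, 5`).  Here
the classical extremal cap of `𝔽₃^6` — `112` points (Hill 1978 projectively, Calderbank–Fishburn 1994
affinely; maximal by Potechin 2008) — is written down and certified, giving the `k = 6` rows:

| `N`                                 | 11       | 12       |
|-------------------------------------|----------|----------|
| this file: `Q_ℂ(cw₂^{⊠N}) ≥`         | `27216`  | `81648`  |
| products of the tree's floors (`N ≤ 10`, K41-a/b/c) | `24786 = 102·243` | `65610 = 10935·6` |
| Hamming ceiling `3^N − 3·2^{N−2}`    | `175611` | `528369` |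

(for `6 ≤ N ≤ 10` the `112`-cap gives `112, 336, 1008, 3024, 9072`, below the K41 floors
`243, 612, 1620, 3672, 10935`).

Construction (how the literal below was produced; the kernel only checks the result).  Let
`Q(x) = x₀x₁ + x₂x₃ + x₄² + x₅²`, an elliptic quadratic form on `𝔽₃^6`.  Its `112` singular projective
points and `280` totally singular lines form the generalized quadrangle `Q⁻(5,3)` of order `(3,9)`
(every point on `10` lines, every line with `4` points).  A two-colouring of the points in which every
line is split `2 + 2` — a hemisystem of the dual quadrangle `H(3,9)` (Segre 1965) — is found instantly
by backtracking; either colour class `C` (`56` points) is a projective cap (three collinear points of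
the quadric lie on a totally singular line), i.e. Hill's `56`-cap, and `Λ = C ∪ (−C)` is an affine cap
of size `112`: for `a ≠ ±b` in `Λ` the point `−(a+b)` spans, with `a` and `b`, a projective line
through two cap points, and `−(a + (−a)) = 0 ∉ Λ`.

Certificate: `capFree_of_table` + `decide +kernel` against a `3^6`-entry Boolean membership table (pair
form of `OutsiderSandwichCapSetLift.cwPow_restrictsTo_unitTensor_of_cap`).  Packing cells fed:
`(12,2) ≥ 13608`, `(13,2) ≥ 40824` (`OutsiderSandwichPackFloors.pack_two_of_diagonal`).

Like the other K41 files this one sits inside the import cone of the route file (through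
`OutsiderSandwichCwCubeSubrank`) and uses no route item.  Honest tag: WEAKER·INSTRUMENT.

References: J. S. Ellenberg, D. Gijswijt, Ann. Math. 185 (2017) [EllenbergGijswijt2017];
M. Christandl, P. Vrana, J. Zuiddam, J. Amer. Math. Soc. 36 (2023), §2.1 [ChristandlVranaZuiddam2021];
R. Hill, *Caps and codes*, Discrete Math. 22 (1978); A. R. Calderbank, P. C. Fishburn, *Maximal
three-independent subsets of `{0,1,2}^n`*, Des. Codes Cryptogr. 4 (1994); A. Potechin, *Maximal caps
in `AG(6,3)`*, Des. Codes Cryptogr. 46 (2008); B. Segre, *Forme e geometrie hermitiane*, Ann. Mat.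
Pura Appl. 70 (1965).
-/

namespace Summit.MatrixMultiplication.MatrixMultiplication.Theorems.OutsiderSandwichHillCap

open Literature.Computability.AlgebraicComplexity
open Literature.Barriers.MatrixMultiplication
open Summit.MatrixMultiplication.MatrixMultiplication.Theorems.OutsiderSandwichCapSetLift
open Summit.MatrixMultiplication.MatrixMultiplication.Theorems.OutsiderSandwichPackFloors
  (pack_two_of_diagonal)

/-! ## 1. Table certificates for caps -/

/-- **Table certificate (cap version).**  If a Boolean table `T` contains `Λ` and `T (−(p+q)) = false`
for all `p ≠ q` in `Λ`, then `Λ` is a cap in the pair form consumed by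
`OutsiderSandwichCapSetLift.cwPow_restrictsTo_unitTensor_of_cap`. [new] -/
theorem capFree_of_table {k : ℕ} (Λ : Finset (Fin k → Fin 3)) (T : (Fin k → Fin 3) → Bool)
    (hT : ∀ z ∈ Λ, T z = true) (hP : ∀ p ∈ Λ, ∀ q ∈ Λ, p ≠ q → T (-(p + q)) = false) :
    ∀ p ∈ Λ, ∀ q ∈ Λ, p ≠ q → -(p + q) ∉ Λ := by
  intro p hp q hq hpq hmem
  have h := hP p hp q hq hpq
  rw [hT _ hmem] at h
  exact Bool.noConfusion h

set_option maxHeartbeats 1000000 in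
/-- **The `112`-cap of `𝔽₃^6`** (`Λ = C ∪ (−C)`, `C` = Hill's `56`-cap = one class of a `2+2` halving of
the lines of `Q⁻(5,3)`, see the module docstring), certified by `decide +kernel` (the `3^6`-leaf table
literal needs more than the default elaboration heartbeats). [new] -/
theorem exists_cap_112 : ∃ Λ : Finset (Fin 6 → Fin 3), Λ.card = 112 ∧
    ∀ p ∈ Λ, ∀ q ∈ Λ, p ≠ q → -(p + q) ∉ Λ := by
  refine ⟨{![0, 0, 0, 1, 0, 0], ![0, 0, 0, 2, 0, 0], ![0, 0, 1, 0, 0, 0], ![0, 0, 1, 1, 1, 1],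
    ![0, 0, 1, 1, 1, 2], ![0, 0, 1, 1, 2, 1], ![0, 0, 1, 1, 2, 2], ![0, 0, 1, 2, 0, 1],
    ![0, 0, 1, 2, 0, 2], ![0, 0, 2, 0, 0, 0], ![0, 0, 2, 1, 0, 1], ![0, 0, 2, 1, 0, 2],
    ![0, 0, 2, 2, 1, 1], ![0, 0, 2, 2, 1, 2], ![0, 0, 2, 2, 2, 1], ![0, 0, 2, 2, 2, 2],
    ![0, 1, 0, 1, 0, 0], ![0, 1, 1, 1, 1, 1], ![0, 1, 1, 1, 2, 2], ![0, 1, 1, 2, 1, 0],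
    ![0, 1, 1, 2, 2, 0], ![0, 1, 2, 0, 0, 0], ![0, 1, 2, 1, 0, 1], ![0, 1, 2, 1, 0, 2],
    ![0, 1, 2, 1, 1, 0], ![0, 1, 2, 1, 2, 0], ![0, 1, 2, 2, 1, 2], ![0, 1, 2, 2, 2, 1],
    ![0, 2, 0, 2, 0, 0], ![0, 2, 1, 0, 0, 0], ![0, 2, 1, 1, 1, 2], ![0, 2, 1, 1, 2, 1],
    ![0, 2, 1, 2, 0, 1], ![0, 2, 1, 2, 0, 2], ![0, 2, 1, 2, 1, 0], ![0, 2, 1, 2, 2, 0],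
    ![0, 2, 2, 1, 1, 0], ![0, 2, 2, 1, 2, 0], ![0, 2, 2, 2, 1, 1], ![0, 2, 2, 2, 2, 2],
    ![1, 0, 0, 2, 0, 0], ![1, 0, 1, 0, 0, 0], ![1, 0, 1, 1, 1, 1], ![1, 0, 1, 1, 2, 2],
    ![1, 0, 1, 2, 0, 1], ![1, 0, 1, 2, 0, 2], ![1, 0, 1, 2, 1, 0], ![1, 0, 1, 2, 2, 0],
    ![1, 0, 2, 1, 1, 0], ![1, 0, 2, 1, 2, 0], ![1, 0, 2, 2, 1, 2], ![1, 0, 2, 2, 2, 1],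
    ![1, 1, 0, 1, 1, 2], ![1, 1, 0, 1, 2, 1], ![1, 1, 0, 2, 1, 1], ![1, 1, 0, 2, 2, 2],
    ![1, 1, 1, 0, 1, 2], ![1, 1, 1, 0, 2, 1], ![1, 1, 1, 1, 0, 1], ![1, 1, 1, 1, 0, 2],
    ![1, 1, 2, 0, 1, 1], ![1, 1, 2, 0, 2, 2], ![1, 1, 2, 2, 0, 1], ![1, 1, 2, 2, 0, 2],
    ![1, 2, 0, 0, 0, 1], ![1, 2, 0, 0, 0, 2], ![1, 2, 0, 2, 1, 0], ![1, 2, 0, 2, 2, 0],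
    ![1, 2, 1, 0, 1, 0], ![1, 2, 1, 0, 2, 0], ![1, 2, 1, 1, 0, 0], ![1, 2, 1, 2, 1, 1],
    ![1, 2, 1, 2, 1, 2], ![1, 2, 1, 2, 2, 1], ![1, 2, 1, 2, 2, 2], ![1, 2, 2, 2, 0, 0],
    ![2, 0, 0, 1, 0, 0], ![2, 0, 1, 1, 1, 2], ![2, 0, 1, 1, 2, 1], ![2, 0, 1, 2, 1, 0],
    ![2, 0, 1, 2, 2, 0], ![2, 0, 2, 0, 0, 0], ![2, 0, 2, 1, 0, 1], ![2, 0, 2, 1, 0, 2],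
    ![2, 0, 2, 1, 1, 0], ![2, 0, 2, 1, 2, 0], ![2, 0, 2, 2, 1, 1], ![2, 0, 2, 2, 2, 2],
    ![2, 1, 0, 0, 0, 1], ![2, 1, 0, 0, 0, 2], ![2, 1, 0, 1, 1, 0], ![2, 1, 0, 1, 2, 0],
    ![2, 1, 1, 1, 0, 0], ![2, 1, 2, 0, 1, 0], ![2, 1, 2, 0, 2, 0], ![2, 1, 2, 1, 1, 1],
    ![2, 1, 2, 1, 1, 2], ![2, 1, 2, 1, 2, 1], ![2, 1, 2, 1, 2, 2], ![2, 1, 2, 2, 0, 0],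
    ![2, 2, 0, 1, 1, 1], ![2, 2, 0, 1, 2, 2], ![2, 2, 0, 2, 1, 2], ![2, 2, 0, 2, 2, 1],
    ![2, 2, 1, 0, 1, 1], ![2, 2, 1, 0, 2, 2], ![2, 2, 1, 1, 0, 1], ![2, 2, 1, 1, 0, 2],
    ![2, 2, 2, 0, 1, 2], ![2, 2, 2, 0, 2, 1], ![2, 2, 2, 2, 0, 1], ![2, 2, 2, 2, 0, 2]}, by decide +kernel, capFree_of_table _
    (fun z => (![![![![![![false, false, false], ![false, false, false], ![false, false, false]], ![![true,
      false, false], ![false, false, false], ![false, false, false]], ![![true, false, false],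
      ![false, false, false], ![false, false, false]]], ![![![true, false, false], ![false,
      false, false], ![false, false, false]], ![![false, false, false], ![false, true, true],
      ![false, true, true]], ![![false, true, true], ![false, false, false], ![false, false,
      false]]], ![![![true, false, false], ![false, false, false], ![false, false, false]],
      ![![false, true, true], ![false, false, false], ![false, false, false]], ![![false, false,
      false], ![false, true, true], ![false, true, true]]]], ![![![![false, false, false],
      ![false, false, false], ![false, false, false]], ![![true, false, false], ![false, false,
      false], ![false, false, false]], ![![false, false, false], ![false, false, false],
      ![false, false, false]]], ![![![false, false, false], ![false, false, false], ![false,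
      false, false]], ![![false, false, false], ![false, true, false], ![false, false, true]],
      ![![false, false, false], ![true, false, false], ![true, false, false]]], ![![![true,
      false, false], ![false, false, false], ![false, false, false]], ![![false, true, true],
      ![true, false, false], ![true, false, false]], ![![false, false, false], ![false, false,
      true], ![false, true, false]]]], ![![![![false, false, false], ![false, false, false],
      ![false, false, false]], ![![false, false, false], ![false, false, false], ![false, false,
      false]], ![![true, false, false], ![false, false, false], ![false, false, false]]],
      ![![![true, false, false], ![false, false, false], ![false, false, false]], ![![false,
      false, false], ![false, false, true], ![false, true, false]], ![![false, true, true],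
      ![true, false, false], ![true, false, false]]], ![![![false, false, false], ![false,
      false, false], ![false, false, false]], ![![false, false, false], ![true, false, false],
      ![true, false, false]], ![![false, false, false], ![false, true, false], ![false, false,
      true]]]]], ![![![![![false, false, false], ![false, false, false], ![false, false,
      false]], ![![false, false, false], ![false, false, false], ![false, false, false]],
      ![![true, false, false], ![false, false, false], ![false, false, false]]], ![![![true,
      false, false], ![false, false, false], ![false, false, false]], ![![false, false, false],
      ![false, true, false], ![false, false, true]], ![![false, true, true], ![true, false,
      false], ![true, false, false]]], ![![![false, false, false], ![false, false, false],
      ![false, false, false]], ![![false, false, false], ![true, false, false], ![true, false,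
      false]], ![![false, false, false], ![false, false, true], ![false, true, false]]]],
      ![![![![false, false, false], ![false, false, false], ![false, false, false]], ![![false,
      false, false], ![false, false, true], ![false, true, false]], ![![false, false, false],
      ![false, true, false], ![false, false, true]]], ![![![false, false, false], ![false,
      false, true], ![false, true, false]], ![![false, true, true], ![false, false, false],
      ![false, false, false]], ![![false, false, false], ![false, false, false], ![false, false,
      false]]], ![![![false, false, false], ![false, true, false], ![false, false, true]],
      ![![false, false, false], ![false, false, false], ![false, false, false]], ![![false,
      true, true], ![false, false, false], ![false, false, false]]]], ![![![![false, true,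
      true], ![false, false, false], ![false, false, false]], ![![false, false, false], ![false,
      false, false], ![false, false, false]], ![![false, false, false], ![true, false, false],
      ![true, false, false]]], ![![![false, false, false], ![true, false, false], ![true, false,
      false]], ![![true, false, false], ![false, false, false], ![false, false, false]],
      ![![false, false, false], ![false, true, true], ![false, true, true]]], ![![![false,
      false, false], ![false, false, false], ![false, false, false]], ![![false, false, false],
      ![false, false, false], ![false, false, false]], ![![true, false, false], ![false, false,
      false], ![false, false, false]]]]], ![![![![![false, false, false], ![false, false,
      false], ![false, false, false]], ![![true, false, false], ![false, false, false], ![false,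
      false, false]], ![![false, false, false], ![false, false, false], ![false, false,
      false]]], ![![![false, false, false], ![false, false, false], ![false, false, false]],
      ![![false, false, false], ![false, false, true], ![false, true, false]], ![![false, false,
      false], ![true, false, false], ![true, false, false]]], ![![![true, false, false],
      ![false, false, false], ![false, false, false]], ![![false, true, true], ![true, false,
      false], ![true, false, false]], ![![false, false, false], ![false, true, false], ![false,
      false, true]]]], ![![![![false, true, true], ![false, false, false], ![false, false,
      false]], ![![false, false, false], ![true, false, false], ![true, false, false]],
      ![![false, false, false], ![false, false, false], ![false, false, false]]], ![![![false,
      false, false], ![false, false, false], ![false, false, false]], ![![true, false, false],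
      ![false, false, false], ![false, false, false]], ![![false, false, false], ![false, false,
      false], ![false, false, false]]], ![![![false, false, false], ![true, false, false],
      ![true, false, false]], ![![false, false, false], ![false, true, true], ![false, true,
      true]], ![![true, false, false], ![false, false, false], ![false, false, false]]]],
      ![![![![false, false, false], ![false, false, false], ![false, false, false]], ![![false,
      false, false], ![false, true, false], ![false, false, true]], ![![false, false, false],
      ![false, false, true], ![false, true, false]]], ![![![false, false, false], ![false, true,
      false], ![false, false, true]], ![![false, true, true], ![false, false, false], ![false,
      false, false]], ![![false, false, false], ![false, false, false], ![false, false,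
      false]]], ![![![false, false, false], ![false, false, true], ![false, true, false]],
      ![![false, false, false], ![false, false, false], ![false, false, false]], ![![false,
      true, true], ![false, false, false], ![false, false, false]]]]]] : Fin 3 → Fin 3 → Fin 3 → Fin 3 → Fin 3 → Fin 3 → Bool)
      (z 0) (z 1) (z 2) (z 3) (z 4) (z 5)) ?_ ?_⟩
  · decide +kernel
  · decide +kernel

/-! ## 2. Floors at `N = 11, 12` and two packing cells -/

/-- **`cw₂^{⊠11} ≥ ⟨27216⟩`** over `ℂ` (`27216 = 112·3^5`; products of earlier floors: `24786`;
Hamming ceiling `175611`). [new] -/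
theorem floor_eleven : TensorRestrictsTo (kroneckerPow (cwTensor ℂ 2) 11) (unitTensor ℂ 27216) ∧
    27216 ≤ subrank ℂ (kroneckerPow (cwTensor ℂ 2) 11) := by
  obtain ⟨Λ, hc, hΛ⟩ := exists_cap_112
  exact le_subrank_cwPow_of_cap (by norm_num) (by norm_num) Λ hΛ (by norm_num [hc])

/-- **`cw₂^{⊠12} ≥ ⟨81648⟩`** over `ℂ` (`81648 = 112·3^6`; products of earlier floors: `65610`;
Hamming ceiling `528369`). [new] -/
theorem floor_twelve : TensorRestrictsTo (kroneckerPow (cwTensor ℂ 2) 12) (unitTensor ℂ 81648) ∧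
    81648 ≤ subrank ℂ (kroneckerPow (cwTensor ℂ 2) 12) := by
  obtain ⟨Λ, hc, hΛ⟩ := exists_cap_112
  exact le_subrank_cwPow_of_cap (by norm_num) (by norm_num) Λ hΛ (by norm_num [hc])

/-- The census floors `Q_ℂ(cw₂^{⊠11}) ≥ 27216`, `Q_ℂ(cw₂^{⊠12}) ≥ 81648`. [new] -/
theorem subrank_floors :
    27216 ≤ subrank ℂ (kroneckerPow (cwTensor ℂ 2) 11) ∧
      81648 ≤ subrank ℂ (kroneckerPow (cwTensor ℂ 2) 12) :=
  ⟨floor_eleven.2, floor_twelve.2⟩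

/-- `(12,2)`: `13608·⟨2,2,2⟩ ≤ cw₂^{⊠12}` (`27216 = 13608·2` at `N = 11`). [new] -/
theorem pack_13608_mmTwo_le_cwPow_12 : TensorRestrictsTo (kroneckerPow (cwTensor ℂ 2) 12)
    (kroneckerTensor (unitTensor ℂ 13608) (matMulTensor ℂ 2 2 2)) :=
  pack_two_of_diagonal floor_eleven.1

/-- `(13,2)`: `40824·⟨2,2,2⟩ ≤ cw₂^{⊠13}` (`81648 = 40824·2` at `N = 12`). [new] -/
theorem pack_40824_mmTwo_le_cwPow_13 : TensorRestrictsTo (kroneckerPow (cwTensor ℂ 2) 13)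
    (kroneckerTensor (unitTensor ℂ 40824) (matMulTensor ℂ 2 2 2)) :=
  pack_two_of_diagonal floor_twelve.1

end Summit.MatrixMultiplication.MatrixMultiplication.Theorems.OutsiderSandwichHillCap
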